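import Mathlib
import Literature.Computability.AlgebraicComplexity.FastFourierTransform
import HarnessLib

/-!
# The FFT as iterated butterfly passes over a flat list (breadth-first form, bit-reversed output)

Topic `Computability/AlgebraicComplexity`, continuing `FastFourierTransform.lean` (`fft`, the
radix-2 decimation-in-frequency FFT as a recursive function, `fft_eq_dft`).  A sequential
machine (tapes, stacks) does not run the recursion depth-first: it makes `k` PASSES over the
whole array, pass `s` applying the butterfly `(u, v) ↦ (u + v, (u − v)ω_s^i)` to every block of
length `2^{k-s}` (GG Fig. 8.5, the FFT circuit read column by column), and the result appears
in **bit-reversed order**.  This file proves that reading: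

* `butterfly h ω blk` — one block: `[u_i + v_i]_{i<h} ++ [(u_i − v_i) ω^i]_{i<h}`;
* `fftBR k ω l` — the depth-first FFT on lists with the two halves APPENDED (not interleaved),
  and **`getD_fftBR`**: `(fftBR k ω l)[p] = fft k ω l (bitrev k p)` (`bitrev` the bit-reversal
  permutation of `k`-bit indices);
* `chunkFlatMap n c f` — apply `f` to `c` consecutive chunks of length `n` (the shape of one
  machine pass), with `chunkFlatMap_append` and the composition lemma `chunkFlatMap_comp`;
* `fftStages k c ω l` — the **breadth-first** FFT: pass with blocks `2^k` on `c` chunks, then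
  recursively with `ω²` on `2c` chunks — and **`fftStages_eq_chunkFlatMap_fftBR`**: on a list of
  `c` chunks of length `2^k` it computes `fftBR k ω` chunkwise; with `getD_fftBR`, pass-by-pass
  execution computes `fft` up to `bitrev` (`getD_fftStages`).

## References

* J. von zur Gathen, J. Gerhard, *Modern Computer Algebra*, CUP (1st ed. 1999, 3rd ed. 2013),
  §8.2, Algorithm 8.14 and Fig. 8.4–8.5 (butterfly circuit). [GathenGerhard2013]
-/

namespace Literature.Computability.AlgebraicComplexity

variable {S : Type*} [CommRing S]

/-! ### `fft` reads its input only below `2^k` -/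

/-- `fft k ω a j` depends only on `a i` for `i < 2^k`. [folklore] -/
theorem fft_congr : ∀ (k : ℕ) (ω : S) {a b : ℕ → S}, (∀ i < 2 ^ k, a i = b i) →
    ∀ j, fft k ω a j = fft k ω b j
  | 0, ω, a, b, h, j => by simp [fft, h 0 (by norm_num)]
  | k + 1, ω, a, b, h, j => by
    have hlen : 2 ^ (k + 1) = 2 ^ k + 2 ^ k := by rw [pow_succ, mul_two]
    rw [fft, fft]
    split_ifs
    · exact fft_congr k _ (fun i hi => by rw [h i (by omega), h (2 ^ k + i) (by omega)]) _
    · exact fft_congr k _ (fun i hi => by rw [h i (by omega), h (2 ^ k + i) (by omega)]) _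

/-! ### Butterflies and the depth-first FFT on lists -/

/-- Reading a `map` over `range`. [folklore] -/
theorem getD_map_range (f : ℕ → S) {h i : ℕ} (hi : i < h) :
    ((List.range h).map f).getD i 0 = f i := by
  rw [List.getD_eq_getElem _ _ (by simpa using hi), List.getElem_map, List.getElem_range]

/-- The top half of a butterfly pass on one block of length `2h`: `u_i + v_i`. [cite: GathenGerhard2013, §8.2 Algorithm 8.14 step 2] -/
def bfTop (h : ℕ) (blk : List S) : List S :=
  (List.range h).map fun i => blk.getD i 0 + blk.getD (h + i) 0

/-- The bottom half of a butterfly pass: `(u_i − v_i) ω^i`. [cite: GathenGerhard2013, §8.2 Algorithm 8.14 step 2] -/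
def bfBot (h : ℕ) (ω : S) (blk : List S) : List S :=
  (List.range h).map fun i => (blk.getD i 0 - blk.getD (h + i) 0) * ω ^ i

/-- One butterfly block: top half then bottom half. [cite: GathenGerhard2013, §8.2 Fig. 8.4] -/
def butterfly (h : ℕ) (ω : S) (blk : List S) : List S := bfTop h blk ++ bfBot h ω blk

/-- `bfTop h` has length `h`. [folklore] -/
@[simp] theorem length_bfTop (h : ℕ) (blk : List S) : (bfTop h blk).length = h := by
  simp [bfTop]

/-- `bfBot h` has length `h`. [folklore] -/
@[simp] theorem length_bfBot (h : ℕ) (ω : S) (blk : List S) : (bfBot h ω blk).length = h := by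
  simp [bfBot]

/-- A butterfly block has length `2h`. [folklore] -/
@[simp] theorem length_butterfly (h : ℕ) (ω : S) (blk : List S) :
    (butterfly h ω blk).length = h + h := by
  simp [butterfly]

/-- The **depth-first FFT on lists with appended halves**: the output is `fft` in bit-reversed
order (`getD_fftBR`). [cite: GathenGerhard2013, §8.2 Algorithm 8.14] -/
def fftBR : ℕ → S → List S → List S
  | 0, _, l => [l.getD 0 0]
  | k + 1, ω, l => fftBR k (ω * ω) (bfTop (2 ^ k) l) ++ fftBR k (ω * ω) (bfBot (2 ^ k) ω l)

/-- `fftBR k` has length `2^k`. [folklore] -/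
@[simp] theorem length_fftBR : ∀ (k : ℕ) (ω : S) (l : List S), (fftBR k ω l).length = 2 ^ k
  | 0, _, _ => rfl
  | k + 1, ω, l => by
    rw [fftBR, List.length_append, length_fftBR k, length_fftBR k, pow_succ, mul_two]

/-- The **bit-reversal permutation** of `k`-bit indices, in the recursive form matching the
decimation in frequency: the top bit of the position becomes the bottom bit of the frequency.
[folklore] -/
def bitrev : ℕ → ℕ → ℕ
  | 0, _ => 0
  | k + 1, p => if p < 2 ^ k then 2 * bitrev k p else 2 * bitrev k (p - 2 ^ k) + 1

/-- `bitrev k` maps `[0, 2^k)` into `[0, 2^k)`. [folklore] -/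
theorem bitrev_lt : ∀ (k p : ℕ), bitrev k p < 2 ^ k
  | 0, _ => by simp [bitrev]
  | k + 1, p => by
    have := bitrev_lt k p
    have := bitrev_lt k (p - 2 ^ k)
    rw [bitrev, pow_succ]
    split_ifs <;> omega

/-- **The list FFT is `fft` in bit-reversed order**: for `p < 2^k`,
`(fftBR k ω l)[p] = fft k ω (l[·]) (bitrev k p)`. [cite: GathenGerhard2013, §8.2 Algorithm 8.14] -/
theorem getD_fftBR : ∀ (k : ℕ) (ω : S) (l : List S) (p : ℕ), p < 2 ^ k →
    (fftBR k ω l).getD p 0 = fft k ω (fun i => l.getD i 0) (bitrev k p)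
  | 0, ω, l, p, hp => by
    have : p = 0 := by simpa using hp
    subst this
    simp [fftBR, fft]
  | k + 1, ω, l, p, hp => by
    have hlen : 2 ^ (k + 1) = 2 ^ k + 2 ^ k := by rw [pow_succ, mul_two]
    rw [fftBR, bitrev]
    by_cases hpk : p < 2 ^ k
    · rw [List.getD_append _ _ _ _ (by simpa using hpk), if_pos hpk, getD_fftBR k _ _ _ hpk, fft,
        if_pos (by omega), show 2 * bitrev k p / 2 = bitrev k p by omega]
      refine fft_congr k _ (fun i hi => ?_) _
      simp only [bfTop]
      rw [getD_map_range _ hi]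
    · rw [List.getD_append_right _ _ _ _ (by simpa using Nat.le_of_not_lt hpk), length_fftBR,
        if_neg hpk, getD_fftBR k _ _ _ (by omega), fft, if_neg (by omega),
        show (2 * bitrev k (p - 2 ^ k) + 1) / 2 = bitrev k (p - 2 ^ k) by omega]
      refine fft_congr k _ (fun i hi => ?_) _
      simp only [bfBot]
      rw [getD_map_range _ hi]

/-! ### Chunkwise passes -/

/-- Apply `f` to `c` consecutive chunks of length `n` of a list and concatenate the results
(the shape of one pass of a sequential machine over an array of blocks). [folklore] -/
def chunkFlatMap (n : ℕ) : ℕ → (List S → List S) → List S → List S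
  | 0, _, _ => []
  | c + 1, f, l => f (l.take n) ++ chunkFlatMap n c f (l.drop n)

omit [CommRing S] in
/-- Passes distribute over concatenation at chunk boundaries. [folklore] -/
theorem chunkFlatMap_append (n : ℕ) (f : List S → List S) :
    ∀ (c₁ c₂ : ℕ) (A B : List S), A.length = c₁ * n →
      chunkFlatMap n (c₁ + c₂) f (A ++ B) = chunkFlatMap n c₁ f A ++ chunkFlatMap n c₂ f B
  | 0, c₂, A, B, hA => by
    have : A = [] := List.eq_nil_of_length_eq_zero (by simpa using hA)
    subst this
    simp [chunkFlatMap]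
  | c₁ + 1, c₂, A, B, hA => by
    have hn : n ≤ A.length := by rw [hA, add_mul, one_mul]; omega
    rw [Nat.add_right_comm, chunkFlatMap, chunkFlatMap, List.take_append_of_le_length hn,
      List.drop_append_of_le_length hn, List.append_assoc,
      chunkFlatMap_append n f c₁ c₂ (A.drop n) B (by rw [List.length_drop, hA]; ring_nf; omega)]

omit [CommRing S] in
/-- Length of a pass whose block map has constant output length. [folklore] -/
theorem length_chunkFlatMap {n m : ℕ} {f : List S → List S} (hf : ∀ blk, (f blk).length = m) :
    ∀ (c : ℕ) (l : List S), (chunkFlatMap n c f l).length = c * m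
  | 0, l => by simp [chunkFlatMap]
  | c + 1, l => by
    rw [chunkFlatMap, List.length_append, hf, length_chunkFlatMap hf c, add_mul, one_mul, add_comm]

omit [CommRing S] in
/-- **Composition of passes**: a finer pass after a pass equals one pass whose block map is
"the block map followed by the finer pass on its output", provided the block map has constant
output length `r·n'`. [folklore] -/
theorem chunkFlatMap_comp {n n' r : ℕ} {f g : List S → List S}
    (hf : ∀ blk, (f blk).length = r * n') :
    ∀ (c : ℕ) (l : List S),
      chunkFlatMap n' (c * r) g (chunkFlatMap n c f l) =
        chunkFlatMap n c (fun blk => chunkFlatMap n' r g (f blk)) l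
  | 0, l => by simp [chunkFlatMap]
  | c + 1, l => by
    rw [chunkFlatMap, chunkFlatMap, Nat.succ_mul, add_comm (c * r) r,
      chunkFlatMap_append n' g r (c * r) _ _ (hf _), chunkFlatMap_comp hf c]

/-- A pass with singleton blocks mapped to themselves is the identity. [folklore] -/
theorem chunkFlatMap_one_singleton : ∀ (c : ℕ) (l : List S), l.length = c →
    chunkFlatMap 1 c (fun blk => [blk.getD 0 0]) l = l
  | 0, l, hl => by
    have : l = [] := List.eq_nil_of_length_eq_zero hl
    subst this; rfl
  | c + 1, l, hl => by
    obtain _ | ⟨x, l⟩ := l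
    · simp at hl
    · simp only [List.length_cons, Nat.add_right_cancel_iff] at hl
      rw [chunkFlatMap]
      simp only [List.take_succ_cons, List.take_zero, List.drop_succ_cons, List.drop_zero,
        List.getD_cons_zero]
      rw [chunkFlatMap_one_singleton c l hl]
      rfl

/-! ### The breadth-first FFT -/

/-- **The breadth-first (pass-by-pass) FFT**: on a list made of `c` chunks of length `2^k`,
apply the butterfly pass with blocks of length `2^k` (halves `2^{k-1}`), then recursively the
passes for `ω²` on the `2c` chunks of length `2^{k-1}`. [cite: GathenGerhard2013, §8.2 Fig. 8.5] -/
def fftStages : ℕ → ℕ → S → List S → List S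
  | 0, _, _, l => l
  | k + 1, c, ω, l =>
      fftStages k (2 * c) (ω * ω) (chunkFlatMap (2 ^ (k + 1)) c (butterfly (2 ^ k) ω) l)

/-- **Breadth-first equals depth-first, chunkwise**: on `c` chunks of length `2^k`,
`fftStages k c ω l = chunkFlatMap (2^k) c (fftBR k ω) l`. [folklore] -/
theorem fftStages_eq_chunkFlatMap_fftBR : ∀ (k c : ℕ) (ω : S) (l : List S),
    l.length = c * 2 ^ k → fftStages k c ω l = chunkFlatMap (2 ^ k) c (fftBR k ω) l
  | 0, c, ω, l, hl => by
    rw [fftStages, pow_zero, show fftBR 0 ω = (fun blk : List S => [blk.getD 0 0]) from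
      funext fun _ => rfl, chunkFlatMap_one_singleton c l (by simpa using hl)]
  | k + 1, c, ω, l, hl => by
    have hlen : 2 ^ (k + 1) = 2 ^ k + 2 ^ k := by rw [pow_succ, mul_two]
    have hbf : ∀ blk : List S, (butterfly (2 ^ k) ω blk).length = 2 * 2 ^ k := by
      intro blk; rw [length_butterfly]; ring
    rw [fftStages, fftStages_eq_chunkFlatMap_fftBR k (2 * c) (ω * ω) _
      (by rw [length_chunkFlatMap hbf]; ring), mul_comm 2 c, chunkFlatMap_comp hbf c l]
    congr 1
    funext blk
    rw [fftBR, butterfly, show (2 : ℕ) = 1 + 1 from rfl,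
      chunkFlatMap_append (2 ^ k) (fftBR k (ω * ω)) 1 1 _ _ (by simp)]
    simp [chunkFlatMap, List.take_of_length_le]

/-- **Pass-by-pass execution computes the FFT up to bit reversal**: on one block `l` of length
`2^k`, position `p` of `fftStages k 1 ω l` holds `fft k ω l (bitrev k p)`. [cite: GathenGerhard2013, §8.2 Algorithm 8.14 / Fig. 8.5] -/
theorem getD_fftStages (k : ℕ) (ω : S) (l : List S) (hl : l.length = 2 ^ k) {p : ℕ}
    (hp : p < 2 ^ k) :
    (fftStages k 1 ω l).getD p 0 = fft k ω (fun i => l.getD i 0) (bitrev k p) := by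
  rw [fftStages_eq_chunkFlatMap_fftBR k 1 ω l (by simpa using hl)]
  simp only [chunkFlatMap, List.append_nil]
  rw [List.take_of_length_le hl.le, getD_fftBR k ω l p hp]

end Literature.Computability.AlgebraicComplexity
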